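import Literature.NumberTheory.LFunctions.HilbertInequalitySpacing

/-!
# Spacing sums for the weighted Hilbert inequality, II: the two-pole sum

The second spacing lemma in Shan's proof of the Montgomery–Vaughan weighted Hilbert inequality, as
printed in Pan Chengdong–Pan Chengbiao, *Foundations of analytic number theory*, Ch. 28 §4, Lemma 3:
for a `δ`-separated configuration (`0 < δ_r ≤ |x_r - x_s|` for `r ≠ s`) and `s ≠ t`,

`∑_{r ≠ s, t} δ_r (x_r - x_s)^{-2} (x_r - x_t)^{-2} ≤ 4 (δ_s^{-1} + δ_t^{-1}) (x_s - x_t)^{-2}`.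

## Proof (loc. cit.)

`f(y) = (y - x_s)^{-2}(y - x_t)^{-2}` is convex on each component of `ℝ ∖ {x_s, x_t}`, so by the
packing principle (`sum_le_integral_of_disjoint`) the sum is at most `∫ f` over
`[A, x_s - δ_s/2] ∪ [x_s + δ_s/2, x_t - δ_t/2] ∪ [x_t + δ_t/2, B]`; with `L = x_t - x_s`,
`B₁ = L^{-2}`, `B₂ = -2L^{-3}`, an antiderivative is
`F(y) = -B₁ (y-x_s)^{-1} - B₁ (y-x_t)^{-1} + B₂ log |(y-x_t)/(y-x_s)|`, and a direct evaluation
(the logarithms combine with the right sign, and `F(A) ≥ 0 ≥ F(B)` by `log τ ≤ (τ - τ⁻¹)/2`)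
gives the bound `2B₁(2/δ_s + 2/δ_t)`.

## Sources

* Pan Chengdong, Pan Chengbiao, *解析数论基础*, Science Press 1991, Ch. 28 §4, Lemma 3 and (31).
-/

open Real MeasureTheory Set

namespace Literature.NumberTheory.LFunctions.MontgomeryVaughan

/-! ### Convexity of the two-pole kernel -/

/-- Monotonicity of `y ↦ (y - c)^{-2}` to the left of `c`. [folklore] -/
theorem inv_sq_sub_le_left {c y₁ y₂ : ℝ} (h : y₁ ≤ y₂) (h₂ : y₂ < c) :
    ((y₁ - c) ^ 2)⁻¹ ≤ ((y₂ - c) ^ 2)⁻¹ := by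
  have e1 : (y₁ - c) ^ 2 = (c - y₁) ^ 2 := by ring
  have e2 : (y₂ - c) ^ 2 = (c - y₂) ^ 2 := by ring
  rw [e1, e2]
  exact inv_anti₀ (by positivity) (pow_le_pow_left₀ (by linarith) (by linarith) 2)

/-- Monotonicity of `y ↦ (y - c)^{-2}` to the right of `c`. [folklore] -/
theorem inv_sq_sub_le_right {c y₁ y₂ : ℝ} (h : y₁ ≤ y₂) (h₁ : c < y₁) :
    ((y₂ - c) ^ 2)⁻¹ ≤ ((y₁ - c) ^ 2)⁻¹ :=
  inv_anti₀ (by positivity) (pow_le_pow_left₀ (by linarith) (by linarith) 2)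

/-- Convexity of `(y-a)^{-2}(y-b)^{-2}` on the three components of `ℝ ∖ {a, b}` (`a < b`): on the
outer ones as a product of monovarying convex functions, in the middle as
`L^{-2}((y-a)^{-1} + (b-y)^{-1})²`. [folklore] -/
theorem convexOn_two_pole {a b : ℝ} (hab : a < b) :
    ConvexOn ℝ (Iio a) (fun y => ((y - a) ^ 2)⁻¹ * ((y - b) ^ 2)⁻¹) ∧
    ConvexOn ℝ (Ioo a b) (fun y => ((y - a) ^ 2)⁻¹ * ((y - b) ^ 2)⁻¹) ∧
    ConvexOn ℝ (Ioi b) (fun y => ((y - a) ^ 2)⁻¹ * ((y - b) ^ 2)⁻¹) := by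
  have hpa : ConvexOn ℝ (Iio a) (fun y => ((y - a) ^ 2)⁻¹) := convexOn_inv_even_pow_sub_Iio a 1
  have hpb : ConvexOn ℝ (Iio b) (fun y => ((y - b) ^ 2)⁻¹) := convexOn_inv_even_pow_sub_Iio b 1
  have hqa : ConvexOn ℝ (Ioi a) (fun y => ((y - a) ^ 2)⁻¹) := convexOn_inv_pow_sub_Ioi a 2
  have hqb : ConvexOn ℝ (Ioi b) (fun y => ((y - b) ^ 2)⁻¹) := convexOn_inv_pow_sub_Ioi b 2
  refine ⟨?_, ?_, ?_⟩
  · refine hpa.mul (hpb.subset (fun y (hy : y < a) => show y < b by linarith) (convex_Iio a))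
      (fun y _ => by positivity) (fun y _ => by positivity) ?_
    intro i (hi : i < a) j (hj : j < a) hij
    rcases le_or_gt i j with h | h
    · exact inv_sq_sub_le_left h hj
    · exact absurd hij (not_lt.mpr (inv_sq_sub_le_left h.le (show i < b by linarith)))
  · have hg : ConvexOn ℝ (Ioo a b) (fun y => (y - a)⁻¹ + (b - y)⁻¹) := by
      refine ConvexOn.add ?_ ?_
      · refine ((convexOn_inv_pow_sub_Ioi a 1).subset (fun y hy => hy.1) (convex_Ioo a b)).congr ?_
        intro y _; simp only [pow_one]
      · refine ((convexOn_inv_pow_sub_Iio b 1).subset (fun y hy => hy.2) (convex_Ioo a b)).congr ?_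
        intro y _; simp only [pow_one]
    have hg0 : ∀ ⦃y⦄, y ∈ Ioo a b → 0 ≤ (y - a)⁻¹ + (b - y)⁻¹ := by
      intro y hy
      have h1 : 0 < y - a := by linarith [hy.1]
      have h2 : 0 < b - y := by linarith [hy.2]
      positivity
    have hL : 0 ≤ ((b - a) ^ 2)⁻¹ := by positivity
    refine ((hg.pow hg0 2).smul hL).congr ?_
    intro y hy
    have h1 : y - a ≠ 0 := by linarith [hy.1]
    have h2 : b - y ≠ 0 := by linarith [hy.2]
    have h3 : y - b ≠ 0 := by linarith [hy.2]
    have h4 : b - a ≠ 0 := by linarith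
    simp only [Pi.pow_apply, smul_eq_mul]
    field_simp
    ring
  · refine (hqa.subset (fun y (hy : b < y) => show a < y by linarith) (convex_Ioi b)).mul hqb
      (fun y _ => by positivity) (fun y _ => by positivity) ?_
    intro i (hi : b < i) j (hj : b < j) hij
    rcases le_or_gt j i with h | h
    · exact inv_sq_sub_le_right h (show a < j by linarith)
    · exact absurd hij (not_lt.mpr (inv_sq_sub_le_right h.le hi))

/-! ### The integral of the two-pole kernel off the excluded neighbourhoods -/

/-- Antiderivative of `(y-a)^{-2}(y-b)^{-2}` off `{a, b}`: with `L = b - a`,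
`F = -L^{-2}(y-a)^{-1} - L^{-2}(y-b)^{-1} - 2L^{-3}(log|y-b| - log|y-a|)` (partial fractions;
`Real.log` is `log |·|`). [cite: PanPan1991, Ch. 28 §4 Lemma 3] -/
theorem hasDerivAt_two_pole {a b y : ℝ} (hab : a ≠ b) (hya : y ≠ a) (hyb : y ≠ b) :
    HasDerivAt (fun y => -((b - a) ^ 2)⁻¹ * (y - a)⁻¹ - ((b - a) ^ 2)⁻¹ * (y - b)⁻¹ +
        -2 * ((b - a) ^ 3)⁻¹ * (Real.log (y - b) - Real.log (y - a)))
      (((y - a) ^ 2)⁻¹ * ((y - b) ^ 2)⁻¹) y := by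
  have hne : y - a ≠ 0 := sub_ne_zero.mpr hya
  have hne' : y - b ≠ 0 := sub_ne_zero.mpr hyb
  have hL : b - a ≠ 0 := sub_ne_zero.mpr (Ne.symm hab)
  have h1 := ((hasDerivAt_id y).sub_const a).fun_inv hne
  have h2 := ((hasDerivAt_id y).sub_const b).fun_inv hne'
  have h3 := ((hasDerivAt_id y).sub_const b).log hne'
  have h4 := ((hasDerivAt_id y).sub_const a).log hne
  refine (((h1.const_mul (-((b - a) ^ 2)⁻¹)).sub (h2.const_mul (((b - a) ^ 2)⁻¹))).add
    ((h3.sub h4).const_mul (-2 * ((b - a) ^ 3)⁻¹))).congr_deriv ?_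
  simp only [id_eq]
  field_simp
  ring

/-- Evaluation of `∫ (y-a)^{-2}(y-b)^{-2}` over `[a-T, a-α] ∪ [a+α, b-β] ∪ [b+β, b+T]`
(`0 < α, β`, `2α, 2β ≤ b - a`, `α, β ≤ T`): at most `2(b-a)^{-2}(α^{-1} + β^{-1})`.  This is the
computation "由计算可得 `I ≤ 4B₁(δ_s⁻¹ + δ_t⁻¹)`" of Pan–Pan, with `α = δ_s/2`, `β = δ_t/2`.
[cite: PanPan1991, Ch. 28 §4 Lemma 3] -/
theorem integral_two_pole_le {a b α β T : ℝ} (hab : a < b) (hα : 0 < α) (hβ : 0 < β)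
    (hαL : 2 * α ≤ b - a) (hβL : 2 * β ≤ b - a) (hTα : α ≤ T) (hTβ : β ≤ T) :
    ∫ y in (Icc (a - T) (a - α) ∪ Icc (a + α) (b - β)) ∪ Icc (b + β) (b + T),
        ((y - a) ^ 2)⁻¹ * ((y - b) ^ 2)⁻¹ ≤ 2 * ((b - a) ^ 2)⁻¹ * (1 / α + 1 / β) := by
  set L := b - a with hL
  have hL0 : 0 < L := by simp only [hL]; linarith
  have hT0 : 0 < T := lt_of_lt_of_le hα hTα
  set f : ℝ → ℝ := fun y => ((y - a) ^ 2)⁻¹ * ((y - b) ^ 2)⁻¹ with hf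
  set F : ℝ → ℝ := fun y => -(L ^ 2)⁻¹ * (y - a)⁻¹ - (L ^ 2)⁻¹ * (y - b)⁻¹ +
    -2 * (L ^ 3)⁻¹ * (Real.log (y - b) - Real.log (y - a)) with hF
  have hcont : ContinuousOn f {y | y ≠ a ∧ y ≠ b} := by
    refine ContinuousOn.mul ?_ ?_
    · exact ContinuousOn.inv₀ (by fun_prop) fun y hy => pow_ne_zero 2 (sub_ne_zero.mpr hy.1)
    · exact ContinuousOn.inv₀ (by fun_prop) fun y hy => pow_ne_zero 2 (sub_ne_zero.mpr hy.2)
  have hP1ab : ∀ y ∈ Icc (a - T) (a - α), y ≠ a ∧ y ≠ b := fun y hy =>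
    ⟨by intro h; rw [h] at hy; linarith [hy.2], by intro h; rw [h] at hy; linarith [hy.2]⟩
  have hP2ab : ∀ y ∈ Icc (a + α) (b - β), y ≠ a ∧ y ≠ b := fun y hy =>
    ⟨by intro h; rw [h] at hy; linarith [hy.1], by intro h; rw [h] at hy; linarith [hy.2]⟩
  have hP3ab : ∀ y ∈ Icc (b + β) (b + T), y ≠ a ∧ y ≠ b := fun y hy =>
    ⟨by intro h; rw [h] at hy; linarith [hy.1], by intro h; rw [h] at hy; linarith [hy.1]⟩
  have hint1 : IntegrableOn f (Icc (a - T) (a - α)) := (hcont.mono hP1ab).integrableOn_Icc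
  have hint2 : IntegrableOn f (Icc (a + α) (b - β)) := (hcont.mono hP2ab).integrableOn_Icc
  have hint3 : IntegrableOn f (Icc (b + β) (b + T)) := (hcont.mono hP3ab).integrableOn_Icc
  have hd12 : Disjoint (Icc (a - T) (a - α)) (Icc (a + α) (b - β)) :=
    Set.disjoint_left.mpr fun y hy hy' => by linarith [hy.2, hy'.1]
  have hd123 : Disjoint (Icc (a - T) (a - α) ∪ Icc (a + α) (b - β)) (Icc (b + β) (b + T)) := by
    refine Set.disjoint_left.mpr fun y hy hy' => ?_
    rcases hy with hy | hy
    · linarith [hy.2, hy'.1]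
    · linarith [hy.2, hy'.1]
  have hFTC : ∀ p q : ℝ, p ≤ q → (∀ y ∈ Icc p q, y ≠ a ∧ y ≠ b) →
      ∫ y in Icc p q, f y = F q - F p := by
    intro p q hpq havoid
    rw [integral_Icc_eq_integral_Ioc, ← intervalIntegral.integral_of_le hpq]
    have havoid' : ∀ y ∈ uIcc p q, y ≠ a ∧ y ≠ b := by rw [Set.uIcc_of_le hpq]; exact havoid
    refine intervalIntegral.integral_eq_sub_of_hasDerivAt
      (fun y hy => hasDerivAt_two_pole hab.ne (havoid' y hy).1 (havoid' y hy).2) ?_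
    exact (hcont.mono fun y hy => havoid' y hy).intervalIntegrable
  have hI : ∫ y in (Icc (a - T) (a - α) ∪ Icc (a + α) (b - β)) ∪ Icc (b + β) (b + T), f y =
      (F (a - α) - F (a - T)) + (F (b - β) - F (a + α)) + (F (b + T) - F (b + β)) := by
    rw [setIntegral_union hd123 measurableSet_Icc (hint1.union hint2) hint3,
      setIntegral_union hd12 measurableSet_Icc hint1 hint2,
      hFTC _ _ (by linarith) hP1ab, hFTC _ _ (by linarith) hP2ab, hFTC _ _ (by linarith) hP3ab]
  -- the values of `F`
  set B1 : ℝ := (L ^ 2)⁻¹ with hB1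
  set B2 : ℝ := -2 * (L ^ 3)⁻¹ with hB2
  have vA : F (a - T) = B1 / T + B1 / (L + T) + B2 * (Real.log (L + T) - Real.log T) := by
    have e1 : a - T - a = -T := by ring
    have e2 : a - T - b = -(L + T) := by simp only [hL]; ring
    simp only [hF]; rw [e1, e2, Real.log_neg_eq_log, Real.log_neg_eq_log, inv_neg, inv_neg]; ring
  have vB : F (b + T) = -F (a - T) := by
    have e1 : b + T - a = L + T := by simp only [hL]; ring
    have e2 : b + T - b = T := by ring
    rw [vA]; simp only [hF]; rw [e1, e2]; ring
  have v1 : F (a - α) = B1 / α + B1 / (L + α) + B2 * (Real.log (L + α) - Real.log α) := by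
    have e1 : a - α - a = -α := by ring
    have e2 : a - α - b = -(L + α) := by simp only [hL]; ring
    simp only [hF]; rw [e1, e2, Real.log_neg_eq_log, Real.log_neg_eq_log, inv_neg, inv_neg]; ring
  have v2 : F (a + α) = -(B1 / α) + B1 / (L - α) + B2 * (Real.log (L - α) - Real.log α) := by
    have e1 : a + α - a = α := by ring
    have e2 : a + α - b = -(L - α) := by simp only [hL]; ring
    simp only [hF]; rw [e1, e2, Real.log_neg_eq_log, inv_neg]; ring
  have v3 : F (b - β) = -(B1 / (L - β)) + B1 / β + B2 * (Real.log β - Real.log (L - β)) := by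
    have e1 : b - β - a = L - β := by simp only [hL]; ring
    have e2 : b - β - b = -β := by ring
    simp only [hF]; rw [e1, e2, Real.log_neg_eq_log, inv_neg]; ring
  have v4 : F (b + β) = -(B1 / (L + β)) - B1 / β + B2 * (Real.log β - Real.log (L + β)) := by
    have e1 : b + β - a = L + β := by simp only [hL]; ring
    have e2 : b + β - b = β := by ring
    simp only [hF]; rw [e1, e2]; ring
  -- signs
  have hB1pos : 0 < B1 := by positivity
  have hB2neg : B2 ≤ 0 := by
    have : 0 < (L ^ 3)⁻¹ := by positivity
    simp only [hB2]; linarith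
  have hFA : 0 ≤ F (a - T) := by
    have hτ : 1 ≤ (L + T) / T := by rw [le_div_iff₀ hT0]; linarith
    have hlog := log_le_sub_inv_div_two hτ
    have hdiv : Real.log (L + T) - Real.log T = Real.log ((L + T) / T) :=
      (Real.log_div (by positivity) hT0.ne').symm
    have hid : B1 / T + B1 / (L + T) =
        2 * (L ^ 3)⁻¹ * (((L + T) / T - ((L + T) / T)⁻¹) / 2) := by
      simp only [hB1]; field_simp; ring
    have : F (a - T) = 2 * (L ^ 3)⁻¹ *
        ((((L + T) / T - ((L + T) / T)⁻¹) / 2) - Real.log ((L + T) / T)) := by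
      rw [vA, hdiv, mul_sub, ← hid]; simp only [hB2]; ring
    rw [this]
    exact mul_nonneg (by positivity) (by linarith)
  have mono1 : B1 / (L + α) ≤ B1 / (L - α) :=
    div_le_div_of_nonneg_left hB1pos.le (by linarith) (by linarith)
  have mono2 : B1 / (L + β) ≤ B1 / (L - β) :=
    div_le_div_of_nonneg_left hB1pos.le (by linarith) (by linarith)
  have log1 : Real.log (L - α) ≤ Real.log (L + α) := Real.log_le_log (by linarith) (by linarith)
  have log2 : Real.log (L - β) ≤ Real.log (L + β) := Real.log_le_log (by linarith) (by linarith)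
  have hlogterm : B2 * ((Real.log (L + α) - Real.log (L - α)) +
      (Real.log (L + β) - Real.log (L - β))) ≤ 0 :=
    mul_nonpos_of_nonpos_of_nonneg hB2neg (by linarith)
  have hR : 2 * ((b - a) ^ 2)⁻¹ * (1 / α + 1 / β) = 2 * (B1 / α) + 2 * (B1 / β) := by
    simp only [hB1, hL]; ring
  rw [hI, hR, v1, v2, v3, v4, vB]
  linarith [hFA, mono1, mono2, hlogterm]

/-! ### The two-pole spacing sum -/

section TwoPole

variable {ι : Type*} [Fintype ι] [DecidableEq ι] {x δ : ι → ℝ}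

/-- **Two-pole spacing sum** (Pan–Pan, Ch. 28 §4, Lemma 3), ordered version `x_s < x_t`: packing
(`sum_le_integral_of_disjoint`) followed by `integral_two_pole_le`.
[cite: PanPan1991, Ch. 28 §4 Lemma 3] -/
theorem sum_weight_two_pole_le_of_lt (hδ : ∀ r, 0 < δ r)
    (hsep : ∀ r s, r ≠ s → δ r ≤ |x r - x s|) {s t : ι} (hst : s ≠ t) (hlt : x s < x t) :
    ∑ r ∈ (Finset.univ.erase s).erase t, δ r / ((x r - x s) ^ 2 * (x r - x t) ^ 2) ≤
      4 * (1 / δ s + 1 / δ t) / (x s - x t) ^ 2 := by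
  have hδs := hδ s
  have hδt := hδ t
  have hsL : δ s ≤ x t - x s := by
    have := hsep s t hst; rwa [abs_of_neg (by linarith), neg_sub] at this
  have htL : δ t ≤ x t - x s := by
    have := hsep t s hst.symm; rwa [abs_of_pos (by linarith)] at this
  set T : ℝ := ∑ r, (|x r - x s| + |x r - x t| + δ r) with hT
  have hTr : ∀ r, |x r - x s| + |x r - x t| + δ r ≤ T := fun r =>
    Finset.single_le_sum (f := fun r => |x r - x s| + |x r - x t| + δ r)
      (fun i _ => by have := hδ i; positivity) (Finset.mem_univ r)
  have hTs : δ s ≤ T := by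
    have h1 := hTr s
    have h2 := abs_nonneg (x s - x t)
    rw [sub_self, abs_zero, zero_add] at h1
    linarith
  have hTt : δ t ≤ T := by
    have h1 := hTr t
    have h2 := abs_nonneg (x t - x s)
    rw [sub_self, abs_zero, add_zero] at h1
    linarith
  set f : ℝ → ℝ := fun y => ((y - x s) ^ 2)⁻¹ * ((y - x t) ^ 2)⁻¹ with hf
  have hcont : ContinuousOn f {y | y ≠ x s ∧ y ≠ x t} := by
    refine ContinuousOn.mul ?_ ?_
    · exact ContinuousOn.inv₀ (by fun_prop) fun y hy => pow_ne_zero 2 (sub_ne_zero.mpr hy.1)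
    · exact ContinuousOn.inv₀ (by fun_prop) fun y hy => pow_ne_zero 2 (sub_ne_zero.mpr hy.2)
  obtain ⟨hcvL, hcvM, hcvR⟩ := convexOn_two_pole hlt
  -- the three pieces
  set P1 : Set ℝ := Icc (x s - T) (x s - δ s / 2) with hP1
  set P2 : Set ℝ := Icc (x s + δ s / 2) (x t - δ t / 2) with hP2
  set P3 : Set ℝ := Icc (x t + δ t / 2) (x t + T) with hP3
  have hP1ab : ∀ y ∈ P1, y ≠ x s ∧ y ≠ x t := fun y hy =>
    ⟨by intro h; rw [h] at hy; linarith [hy.2], by intro h; rw [h] at hy; linarith [hy.2]⟩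
  have hP2ab : ∀ y ∈ P2, y ≠ x s ∧ y ≠ x t := fun y hy =>
    ⟨by intro h; rw [h] at hy; linarith [hy.1], by intro h; rw [h] at hy; linarith [hy.2]⟩
  have hP3ab : ∀ y ∈ P3, y ≠ x s ∧ y ≠ x t := fun y hy =>
    ⟨by intro h; rw [h] at hy; linarith [hy.1], by intro h; rw [h] at hy; linarith [hy.1]⟩
  have hint : IntegrableOn f ((P1 ∪ P2) ∪ P3) :=
    (((hcont.mono hP1ab).integrableOn_Icc).union ((hcont.mono hP2ab).integrableOn_Icc)).union
      ((hcont.mono hP3ab).integrableOn_Icc)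
  -- positions of the other points
  have hne : ∀ r, r ≠ s → r ≠ t → x r ≠ x s ∧ x r ≠ x t := by
    intro r hrs hrt
    constructor
    · intro h; have := hsep r s hrs; rw [h, sub_self, abs_zero] at this; linarith [hδ r]
    · intro h; have := hsep r t hrt; rw [h, sub_self, abs_zero] at this; linarith [hδ r]
  have hposL : ∀ r, r ≠ s → x r < x s →
      x r + δ r / 2 ≤ x s - δ s / 2 ∧ x s - T ≤ x r - δ r / 2 := by
    intro r hrs h
    have h1 := hsep r s hrs; rw [abs_of_neg (by linarith)] at h1
    have h2 := hsep s r (Ne.symm hrs); rw [abs_of_pos (by linarith)] at h2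
    have h3 := hTr r; rw [abs_of_neg (by linarith : x r - x s < 0)] at h3
    have h4 := abs_nonneg (x r - x t)
    have h5 := hδ r
    constructor <;> linarith
  have hposM : ∀ r, r ≠ s → r ≠ t → x s < x r → x r < x t →
      x s + δ s / 2 ≤ x r - δ r / 2 ∧ x r + δ r / 2 ≤ x t - δ t / 2 := by
    intro r hrs hrt h h'
    have h1 := hsep r s hrs; rw [abs_of_pos (by linarith)] at h1
    have h2 := hsep s r (Ne.symm hrs); rw [abs_of_neg (by linarith)] at h2
    have h3 := hsep r t hrt; rw [abs_of_neg (by linarith)] at h3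
    have h4 := hsep t r (Ne.symm hrt); rw [abs_of_pos (by linarith)] at h4
    constructor <;> linarith
  have hposR : ∀ r, r ≠ t → x t < x r →
      x t + δ t / 2 ≤ x r - δ r / 2 ∧ x r + δ r / 2 ≤ x t + T := by
    intro r hrt h
    have h1 := hsep r t hrt; rw [abs_of_pos (by linarith)] at h1
    have h2 := hsep t r (Ne.symm hrt); rw [abs_of_neg (by linarith)] at h2
    have h3 := hTr r; rw [abs_of_pos (by linarith : 0 < x r - x t)] at h3
    have h4 := abs_nonneg (x r - x s)
    have h5 := hδ r
    constructor <;> linarith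
  -- packing
  have key := sum_le_integral_of_disjoint ((Finset.univ.erase s).erase t) x (fun r => δ r / 2) f
    ((P1 ∪ P2) ∪ P3) ((measurableSet_Icc.union measurableSet_Icc).union measurableSet_Icc)
    (fun r _ => by linarith [hδ r]) ?_ ?_ ?_ ?_ (fun y _ => by positivity) hint
  rotate_left
  · -- convexity on packing intervals
    intro r hr
    obtain ⟨hrt, hr'⟩ := Finset.mem_erase.mp hr
    have hrs := (Finset.mem_erase.mp hr').1
    obtain ⟨hra, hrb⟩ := hne r hrs hrt
    rcases lt_or_gt_of_ne hra with h | h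
    · refine hcvL.subset (fun y hy => ?_) (convex_Icc _ _)
      show y < x s; linarith [hy.2, (hposL r hrs h).1]
    · rcases lt_or_gt_of_ne hrb with h' | h'
      · refine hcvM.subset (fun y hy => ⟨?_, ?_⟩) (convex_Icc _ _)
        · linarith [hy.1, (hposM r hrs hrt h h').1]
        · linarith [hy.2, (hposM r hrs hrt h h').2]
      · refine hcvR.subset (fun y hy => ?_) (convex_Icc _ _)
        show x t < y; linarith [hy.1, (hposR r hrt h').1]
  · -- continuity on packing intervals
    intro r hr
    obtain ⟨hrt, hr'⟩ := Finset.mem_erase.mp hr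
    have hrs := (Finset.mem_erase.mp hr').1
    obtain ⟨hra, hrb⟩ := hne r hrs hrt
    refine hcont.mono fun y hy => ⟨?_, ?_⟩
    · rcases lt_or_gt_of_ne hra with h | h
      · intro e; rw [e] at hy; linarith [hy.2, (hposL r hrs h).1]
      · rcases lt_or_gt_of_ne hrb with h' | h'
        · intro e; rw [e] at hy; linarith [hy.1, (hposM r hrs hrt h h').1]
        · intro e; rw [e] at hy; linarith [hy.1, (hposR r hrt h').1]
    · rcases lt_or_gt_of_ne hra with h | h
      · intro e; rw [e] at hy; linarith [hy.2, (hposL r hrs h).1]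
      · rcases lt_or_gt_of_ne hrb with h' | h'
        · intro e; rw [e] at hy; linarith [hy.2, (hposM r hrs hrt h h').2]
        · intro e; rw [e] at hy; linarith [hy.1, (hposR r hrt h').1]
  · -- packing intervals lie in the three pieces
    intro r hr y hy
    obtain ⟨hrt, hr'⟩ := Finset.mem_erase.mp hr
    have hrs := (Finset.mem_erase.mp hr').1
    obtain ⟨hra, hrb⟩ := hne r hrs hrt
    rcases lt_or_gt_of_ne hra with h | h
    · exact Or.inl (Or.inl ⟨by linarith [hy.1, (hposL r hrs h).2],
        by linarith [hy.2, (hposL r hrs h).1]⟩)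
    · rcases lt_or_gt_of_ne hrb with h' | h'
      · exact Or.inl (Or.inr ⟨by linarith [hy.1, (hposM r hrs hrt h h').1],
          by linarith [hy.2, (hposM r hrs hrt h h').2]⟩)
      · exact Or.inr ⟨by linarith [hy.1, (hposR r hrt h').1],
          by linarith [hy.2, (hposR r hrt h').2]⟩
  · -- pairwise disjoint
    intro r _ r' _ hrr'
    have h1 := hsep r r' hrr'
    have h2 := hsep r' r (Ne.symm hrr')
    rw [abs_sub_comm] at h2
    exact Ioc_disjoint_Ioc_of_add_le_abs (by linarith)
  -- the integral
  have hI := integral_two_pole_le (α := δ s / 2) (β := δ t / 2) (T := T) hlt (by linarith)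
    (by linarith) (by linarith) (by linarith) (by linarith) (by linarith)
  have hR : 2 * ((x t - x s) ^ 2)⁻¹ * (1 / (δ s / 2) + 1 / (δ t / 2)) =
      4 * (1 / δ s + 1 / δ t) / (x s - x t) ^ 2 := by
    have : (x s - x t) ^ 2 = (x t - x s) ^ 2 := by ring
    rw [this]; field_simp; ring
  calc ∑ r ∈ (Finset.univ.erase s).erase t, δ r / ((x r - x s) ^ 2 * (x r - x t) ^ 2)
        = ∑ r ∈ (Finset.univ.erase s).erase t, 2 * (δ r / 2) * f (x r) := by
          refine Finset.sum_congr rfl fun r _ => ?_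
          simp only [hf, div_eq_mul_inv, mul_inv]
          ring
    _ ≤ ∫ y in (P1 ∪ P2) ∪ P3, f y := key
    _ ≤ 2 * ((x t - x s) ^ 2)⁻¹ * (1 / (δ s / 2) + 1 / (δ t / 2)) := hI
    _ = 4 * (1 / δ s + 1 / δ t) / (x s - x t) ^ 2 := hR

/-- **Two-pole spacing sum** (Pan–Pan, *Foundations of analytic number theory*, Ch. 28 §4, Lemma 3,
(31)): for a `δ`-separated configuration and `s ≠ t`,
`∑_{r ≠ s,t} δ_r (x_r - x_s)^{-2}(x_r - x_t)^{-2} ≤ 4(δ_s^{-1} + δ_t^{-1})(x_s - x_t)^{-2}`.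
[cite: PanPan1991, Ch. 28 §4 Lemma 3] -/
theorem sum_weight_two_pole_le (hδ : ∀ r, 0 < δ r)
    (hsep : ∀ r s, r ≠ s → δ r ≤ |x r - x s|) {s t : ι} (hst : s ≠ t) :
    ∑ r ∈ (Finset.univ.erase s).erase t, δ r / ((x r - x s) ^ 2 * (x r - x t) ^ 2) ≤
      4 * (1 / δ s + 1 / δ t) / (x s - x t) ^ 2 := by
  have hne : x s ≠ x t := by
    intro h
    have := hsep s t hst
    rw [h, sub_self, abs_zero] at this
    linarith [hδ s]
  rcases lt_or_gt_of_ne hne with hlt | hgt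
  · exact sum_weight_two_pole_le_of_lt hδ hsep hst hlt
  · have key := sum_weight_two_pole_le_of_lt hδ hsep hst.symm hgt
    calc ∑ r ∈ (Finset.univ.erase s).erase t, δ r / ((x r - x s) ^ 2 * (x r - x t) ^ 2)
          = ∑ r ∈ (Finset.univ.erase t).erase s, δ r / ((x r - x t) ^ 2 * (x r - x s) ^ 2) := by
            rw [Finset.erase_right_comm]
            exact Finset.sum_congr rfl fun r _ => by rw [mul_comm]
      _ ≤ 4 * (1 / δ t + 1 / δ s) / (x t - x s) ^ 2 := key
      _ = 4 * (1 / δ s + 1 / δ t) / (x s - x t) ^ 2 := by rw [add_comm]; ring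

end TwoPole

end Literature.NumberTheory.LFunctions.MontgomeryVaughan
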